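import Summits.Ventures.LatticeQCDFlow.Scaling.ApproximateEigenfunctionFloor
import Summits.Ventures.LatticeQCDFlow.Scaling.PersistentPairEigenfunction
import Summits.Ventures.LatticeQCDFlow.Scaling.LumpedStarPairLumping
import Summits.Ventures.LatticeQCDFlow.Scaling.HomStarPathLumping
import Summits.Ventures.LatticeQCDFlow.Scaling.HomStarPathLumping

/-!
HONEST FRAMING: exact (Metropolis-corrected) sampling algorithms for lattice gauge theory; figures
of merit are autocorrelation/cost numbers at stated couplings and volumes; no continuum-physics
claim.

# LumpedStarPersistentLogFloor — THE LAW-FREE `½·log K` WITH PERSISTENCE: FOR THE LUMPED STAR'S STEP CHAIN WITH ONE DISTINGUISHED CONTENT `u` (`acc(u,·) = α`,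
# `acc(·,u) = β` OFF `u`), **`t_mix^{steps}(1/4) ≥ (K/Λ − 1)·(½·log K − log(72(1+c)²e^{2c}/Λ))`**, `Λ = σ(1−σ)c̄/D₀`, `c = σ/D₀`, `D₀ = (1−σ) + σαβ/c̄`, `c̄ = pα + (1−p)β`,
# `p = μ_0(u)` — UNCONDITIONALLY IN THE CHAIN, FOR EVERY HUB LAW (lean-2 GEN-46, ours)

Venture-side (OURS).  Cell `lqcd-flow` (pub-lqcd), unit `pub-lqcd-lean-2-g46`, 2026-08-31.  Chapter AF (the law-free `½·log K` with persistence), file 5 — the assembly: file 4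
makes `Φ = f(G) + 𝟙{hub = u}κ(G)` (file 3b's explicit pair statistic on the cold `u`-count `G` and the hub indicator) a statistic of X5's step chain `S = σA + (1−σ)B` whose defect
against `1 − Λ/K` is `≤ 4c(1+c)e^c/K` and whose jumps are `≤ (2(1+c)² + c)e^c`; file 1 (Wilson's lower bound with a defect) then gives the floor from the `u`-crowded composition
(`|Φ| ≥ K(1−g⋆)e^{−c}`) or from a `u`-free one (`|Φ| ≥ Kg⋆e^{−c}`), whichever of `g⋆ = pα/c̄`, `1 − g⋆` is `≥ ½`; stationarity of X5's `π_S`, irreducibility (X7) and aperiodicity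
discharge the chain hypotheses as in chapter AE file 2.  The unit `K/Λ = K((1−σ)c̄ + σαβ)/(σ(1−σ)c̄²)` is the mean-field relaxation time of the pair at its equilibrium (`= K/(σ(1−σ))`
at `α = β = 1`, chapter AE file 16's unit); the constant in the logarithm is not optimised.  Hypothesis-equations only, no definitions.

* §1 `persistent_floor_constants` (the arithmetic of file 1's `D`: `(R + 2δ²K/Λ)K/Λ ≤ (7(1+c)²e^c√K/Λ)²`), `persistent_jump_constants`, `persistent_floor_log` (the logarithm: `log(|Φ₀|/M) ≥ ½log K − log(72(1+c)²e^{2c}/Λ)`),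
  `persistent_hubLaw_lt_one` (`μ_0(u) < 1` when another content exists); §2 **`lumpedStar_lazy_mixingTime_ge_persistent`** — the floor for the LAZY lumped chain
  `S_l = tA + hB + (1−t−h)I` (the pooled chain of chapter U's homogeneous scheme by AD8 ∕ AD9, swap probability `t`, hot redraw weight `h = (1−t)w_0`):
  **`t_mix^{S_l}(1/4) ≥ (K/((t+h)Λ) − 1)·(½·log K − log(72(1+c)²e^{2c}/Λ))`** at swap odds `σ = t/(t+h)` (`S_l = (t+h)S_σ + (1−t−h)I`: the defect and the increment bound scale by
  `t+h`, which cancels in file 1's constants), and **`lumpedStar_step_mixingTime_ge_persistent`** — X5's step chain (`t = σ`, `h = 1−σ`), as displayed in the title; both given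
  `K ≥ 2`, `σ ≤ (1−σ)K`, `μ_0 > 0`, a content `w ≠ u`, and the persistence pattern `acc(u,v) = α ∈ (0,1]`, `acc(v,u) = β ∈ (0,1]` off `u`.

Reading (no numerics implied): with chapter AD file 4's ceiling `O((K/((1−σ)σp̄))·log(K/(σp̄ε)))` the step law of the lumped star is two-sided INCLUDING THE LOGARITHM in `K`
with persistence, for every hub law, on this persistence pattern (two contents; one persistent or one volatile content type among equals), and with AD12's
`O((K(t+h)/(thp̄))·log)` so is the pooled law of the venture's homogeneous scheme (unit `K(t+h)/(th)·D₀/c̄`); GEN-45's persistent toy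
(`numerics45/two_content_persistent_toy.py`, nothing claimed) measured `t_mix·σ/K` increments per doubling of `K` of `0.74 ∕ 0.80 ∕ 0.61 ∕ 1.14` at
`(σ, W_u/W_v) = (½,4) ∕ (½,¼) ∕ (¼,16) ∕ (¾,4)` against `(σ/Λ)·½log 2 = 0.78 ∕ 0.78 ∕ 0.63 ∕ 1.22` — the unit `K/Λ` is the observed one.  Literature grade (cell rule): OWN;
mechanism Levin–Peres–Wilmer §13.5 (Wilson 2004) with a defect (file 1); nothing new cited; no new bib keys.
-/

noncomputable section

open Finset Function
open Literature.Probability.MarkovChains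

namespace Summit.Ventures.LatticeQCDFlow.Scaling

/-! ## §1 Arithmetic of the constants -/

/-- **FILE 1's `D`:** with `0 < Λ ≤ 1`, `K ≥ 1`, `0 ≤ δ ≤ 4E₁/K`, `R ≤ 9E₁²`: `(R + 2δ²/(Λ/K))/(Λ/K) ≤ (7E₁√K/Λ)²`. [ours] -/
theorem persistent_floor_constants {Λ K E₁ δ R : ℝ} (hΛ0 : 0 < Λ) (hΛ1 : Λ ≤ 1) (hK : 1 ≤ K) (hδ0 : 0 ≤ δ) (hδ : δ ≤ 4 * E₁ / K)
    (hR : R ≤ 9 * E₁ ^ 2) : (R + 2 * δ ^ 2 / (Λ / K)) / (Λ / K) ≤ (7 * E₁ * Real.sqrt K / Λ) ^ 2 := by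
  have hK0 : 0 < K := by linarith
  have hsq : Real.sqrt K ^ 2 = K := Real.sq_sqrt hK0.le
  have hδ2 : δ ^ 2 ≤ (4 * E₁ / K) ^ 2 := pow_le_pow_left₀ hδ0 hδ 2
  have e1 : (R + 2 * δ ^ 2 / (Λ / K)) / (Λ / K) = (R * K) / Λ + 2 * δ ^ 2 * K ^ 2 / Λ ^ 2 := by field_simp
  have e2 : (7 * E₁ * Real.sqrt K / Λ) ^ 2 = 49 * E₁ ^ 2 * K / Λ ^ 2 := by rw [div_pow, mul_pow, hsq]; ring
  rw [e1, e2]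
  -- `RK/Λ ≤ 9E₁²K/Λ²` and `2δ²K²/Λ² ≤ 32E₁²/Λ² ≤ 32E₁²K/Λ²`
  have h1 : R * K / Λ ≤ 9 * E₁ ^ 2 * K / Λ ^ 2 := by
    rw [div_le_div_iff₀ hΛ0 (pow_pos hΛ0 2)]
    have : R * K * Λ ^ 2 ≤ 9 * E₁ ^ 2 * K * (Λ * 1) := by
      have hRK : R * K ≤ 9 * E₁ ^ 2 * K := mul_le_mul_of_nonneg_right hR hK0.le
      have hΛΛ : Λ ^ 2 ≤ Λ * 1 := by nlinarith
      calc R * K * Λ ^ 2 ≤ 9 * E₁ ^ 2 * K * Λ ^ 2 := mul_le_mul_of_nonneg_right hRK (sq_nonneg _)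
        _ ≤ 9 * E₁ ^ 2 * K * (Λ * 1) := mul_le_mul_of_nonneg_left hΛΛ (by positivity)
    simpa using this
  have h2 : 2 * δ ^ 2 * K ^ 2 / Λ ^ 2 ≤ 32 * E₁ ^ 2 * K / Λ ^ 2 := by
    apply div_le_div_of_nonneg_right _ (pow_pos hΛ0 2).le
    have h3 : δ ^ 2 * K ^ 2 ≤ 16 * E₁ ^ 2 := by
      have := mul_le_mul_of_nonneg_right hδ2 (sq_nonneg K)
      rw [div_pow, div_mul_cancel₀ _ (pow_ne_zero 2 hK0.ne')] at this
      nlinarith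
    nlinarith [sq_nonneg E₁]
  have h4 : 9 * E₁ ^ 2 * K / Λ ^ 2 + 32 * E₁ ^ 2 * K / Λ ^ 2 ≤ 49 * E₁ ^ 2 * K / Λ ^ 2 := by
    rw [← add_div]; apply div_le_div_of_nonneg_right _ (pow_pos hΛ0 2).le; nlinarith [sq_nonneg E₁]
  linarith

/-- **THE JUMP ∕ DEFECT CONSTANTS** against `E₁ = (1+c)²e^c` (`c ≥ 0`): `E₁ ≥ 1`, `4c(1+c)e^c ≤ 4E₁`, `(2(1+c)²e^c + ce^c)² ≤ 9E₁²`. [ours] -/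
theorem persistent_jump_constants {c : ℝ} (hc : 0 ≤ c) :
    1 ≤ (1 + c) ^ 2 * Real.exp c ∧ 4 * c * (1 + c) * Real.exp c ≤ 4 * ((1 + c) ^ 2 * Real.exp c)
      ∧ (2 * (1 + c) ^ 2 * Real.exp c + c * Real.exp c) ^ 2 ≤ 9 * ((1 + c) ^ 2 * Real.exp c) ^ 2 := by
  have he : 1 ≤ Real.exp c := Real.one_le_exp hc
  have he0 : 0 < Real.exp c := Real.exp_pos c
  have h1 : 1 ≤ (1 + c) ^ 2 := by nlinarith
  refine ⟨by nlinarith, ?_, ?_⟩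
  · have : c * (1 + c) ≤ (1 + c) ^ 2 := by nlinarith
    nlinarith
  · have h2 : 2 * (1 + c) ^ 2 * Real.exp c + c * Real.exp c ≤ 3 * ((1 + c) ^ 2 * Real.exp c) := by
      have : c ≤ (1 + c) ^ 2 := by nlinarith
      nlinarith
    have h0 : 0 ≤ 2 * (1 + c) ^ 2 * Real.exp c + c * Real.exp c := by positivity
    calc (2 * (1 + c) ^ 2 * Real.exp c + c * Real.exp c) ^ 2 ≤ (3 * ((1 + c) ^ 2 * Real.exp c)) ^ 2 := pow_le_pow_left₀ h0 h2 2
      _ = 9 * ((1 + c) ^ 2 * Real.exp c) ^ 2 := by ring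

/-- **THE LOGARITHM:** with `0 < Λ ≤ 1`, `K ≥ 1`, `E₁ ≥ 1`, `0 ≤ δ/(Λ/K) ≤ 4E₁/Λ`, `D = 7E₁√K/Λ` and `|Φ₀| ≥ (K/2)e^{−c}`:
`log(|Φ₀|/(2δ/(Λ/K) + 4D)) ≥ ½·log K − log(72E₁e^c/Λ)`. [ours] -/
theorem persistent_floor_log {Λ K E₁ δ c Φ₀ : ℝ} (hΛ0 : 0 < Λ) (hK : 1 ≤ K) (hE : 1 ≤ E₁) (hδ0 : 0 ≤ δ) (hδ : δ / (Λ / K) ≤ 4 * E₁ / Λ)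
    (hΦ : K / 2 * Real.exp (-c) ≤ Φ₀) :
    Real.log K / 2 - Real.log (72 * E₁ * Real.exp c / Λ) ≤ Real.log (Φ₀ / (2 * δ / (Λ / K) + 4 * (7 * E₁ * Real.sqrt K / Λ))) := by
  have hK0 : 0 < K := by linarith
  have hsK : 0 < Real.sqrt K := Real.sqrt_pos.mpr hK0
  have hsK1 : 1 ≤ Real.sqrt K := by rw [← Real.sqrt_one]; exact Real.sqrt_le_sqrt hK
  have hE0 : 0 < E₁ := by linarith
  have hec : 0 < Real.exp c := Real.exp_pos c
  have hΦ0 : 0 < Φ₀ := lt_of_lt_of_le (by positivity) hΦ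
  -- the denominator is at most `36E₁√K/Λ`
  have hM : 2 * δ / (Λ / K) + 4 * (7 * E₁ * Real.sqrt K / Λ) ≤ 36 * E₁ * Real.sqrt K / Λ := by
    have h1 : 2 * δ / (Λ / K) ≤ 8 * E₁ * Real.sqrt K / Λ := by
      have e : 2 * δ / (Λ / K) = 2 * (δ / (Λ / K)) := by ring
      rw [e]
      calc 2 * (δ / (Λ / K)) ≤ 2 * (4 * E₁ / Λ) := by linarith
        _ = 8 * E₁ * 1 / Λ := by ring
        _ ≤ 8 * E₁ * Real.sqrt K / Λ := by
            apply div_le_div_of_nonneg_right _ hΛ0.le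
            exact mul_le_mul_of_nonneg_left hsK1 (by positivity)
    have e2 : 8 * E₁ * Real.sqrt K / Λ + 4 * (7 * E₁ * Real.sqrt K / Λ) = 36 * E₁ * Real.sqrt K / Λ := by ring
    linarith
  have hMpos : 0 < 2 * δ / (Λ / K) + 4 * (7 * E₁ * Real.sqrt K / Λ) := by positivity
  -- `Φ₀/M ≥ (K/2)e^{−c}Λ/(36E₁√K) = √K·Λ/(72E₁e^c)`
  have hratio : Real.sqrt K / (72 * E₁ * Real.exp c / Λ) ≤ Φ₀ / (2 * δ / (Λ / K) + 4 * (7 * E₁ * Real.sqrt K / Λ)) := by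
    have e : Real.sqrt K / (72 * E₁ * Real.exp c / Λ) = (K / 2 * Real.exp (-c)) / (36 * E₁ * Real.sqrt K / Λ) := by
      have hsq : Real.sqrt K * Real.sqrt K = K := Real.mul_self_sqrt hK0.le
      rw [Real.exp_neg]
      field_simp
      nlinarith [hsq]
    rw [e]
    calc K / 2 * Real.exp (-c) / (36 * E₁ * Real.sqrt K / Λ) ≤ Φ₀ / (36 * E₁ * Real.sqrt K / Λ) := div_le_div_of_nonneg_right hΦ (by positivity)
      _ ≤ Φ₀ / (2 * δ / (Λ / K) + 4 * (7 * E₁ * Real.sqrt K / Λ)) := div_le_div_of_nonneg_left hΦ0.le hMpos hM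
  have hlhs : 0 < Real.sqrt K / (72 * E₁ * Real.exp c / Λ) := by positivity
  calc Real.log K / 2 - Real.log (72 * E₁ * Real.exp c / Λ) = Real.log (Real.sqrt K / (72 * E₁ * Real.exp c / Λ)) := by
        rw [Real.log_div hsK.ne' (by positivity), Real.log_sqrt hK0.le]
    _ ≤ Real.log (Φ₀ / (2 * δ / (Λ / K) + 4 * (7 * E₁ * Real.sqrt K / Λ))) := Real.log_le_log hlhs hratio

section PersistentFloor
variable {X : Type*} [Fintype X] [DecidableEq X] {S : Type*} [Fintype S] [DecidableEq S]
variable {hub : X → S} {comp : X → S → ℕ} {K : ℕ} {μ0 W : S → ℝ} {σ : ℝ} {acc : S → S → ℝ} {Kh : (S → ℕ) → S → S → ℝ}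
variable {Ast Bst Sst Sl : X → X → ℝ} {g : (S → ℕ) → ℝ} {πS : X → ℝ} {Z : ℝ}

omit [Fintype X] [DecidableEq X] [DecidableEq S] in
/-- With a second content of positive hub mass, `μ_0(u) < 1`. [ours] -/
theorem persistent_hubLaw_lt_one (hμ1 : ∑ v, μ0 v = 1) (hμpos : ∀ v, 0 < μ0 v) {u w : S} (hw : w ≠ u) : μ0 u < 1 := by
  classical
  have h : μ0 u + μ0 w ≤ ∑ v, μ0 v := by
    rw [← Finset.sum_pair (Ne.symm hw)]
    exact sum_le_sum_of_subset_of_nonneg (subset_univ _) fun v _ _ => (hμpos v).le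
  rw [hμ1] at h
  linarith [hμpos w]

/-! ## §2 The floor in scheme steps: the lazy lumped chain `S_l = tA + hB + (1−t−h)I` -/

/-- **THE LAW-FREE `½·log K` WITH PERSISTENCE, FOR THE LAZY LUMPED CHAIN `S_l = tA + hB + (1−t−h)I`** (`0 < t`, `0 < h`, `t + h ≤ 1`; by chapter AD files 8–9 this is the chain
followed by the pooled law — (hub content, composition) — of chapter U's homogeneous replica-exchange star with swap probability `t` and hot redraw weight `h = (1−t)w_0`; at `h = 1−t`
it is X5's step chain).  With `K ≥ 2`, `μ_0 > 0`, a content `u` and another `w ≠ u`, the persistence pattern `acc(u,v) = α`, `acc(v,u) = β` for `v ≠ u` (`α, β ∈ (0,1]`), the swap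
odds `σ = t/(t+h)` with `σ ≤ (1−σ)K`, and the constants `c̄ = pα + (1−p)β` (`p = μ_0(u)`), `g⋆ = pα/c̄`, `D₀ = (1−σ) + σαβ/c̄`, `Λ = σ(1−σ)c̄/D₀`, `γ = σ(β−α)/D₀`, `c = σ/D₀`:
**`t_mix^{S_l}(1/4) ≥ (K/((t+h)Λ) − 1)·(½·log K − log(72(1+c)²e^{2c}/Λ))`**, unconditionally in the chain — the unit `K/((t+h)Λ) = (K(t+h)/(th))·(D₀/c̄)`. [ours] -/
theorem lumpedStar_lazy_mixingTime_ge_persistent [Nonempty X] (hinj : ∀ x x', hub x = hub x' → comp x = comp x' → x = x')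
    (hsurj : ∀ (z : S) (N : S → ℕ), ∑ v, N v = K + 1 → N z ≠ 0 → ∃ x, hub x = z ∧ comp x = N) (hhub : ∀ x, comp x (hub x) ≠ 0)
    (hsum : ∀ x, ∑ v, comp x v = K + 1) (hK : 2 ≤ K) (hW : ∀ v, 0 < W v) (hacc : ∀ h v, acc h v = min 1 (W h / W v)) (hμ1 : ∑ v, μ0 v = 1) (hμpos : ∀ v, 0 < μ0 v)
    {t h σ : ℝ} (ht0 : 0 < t) (hh0 : 0 < h) (hth : t + h ≤ 1) (hσ : σ = t / (t + h)) (hKσ : σ ≤ (1 - σ) * K)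
    (hKoff : ∀ N h v, h ≠ v → Kh N h v = if N h = 0 then 0 else (N v : ℝ) / K * acc h v) (hKdiag : ∀ N h, Kh N h h = 1 - ∑ v ∈ univ.erase h, Kh N h v)
    (hA : ∀ x x', Ast x x' = if comp x' = comp x then Kh (comp x) (hub x) (hub x') else 0)
    (hB : ∀ x x', Bst x x' = μ0 (hub x') * (if comp x' + Pi.single (hub x) 1 = comp x + Pi.single (hub x') 1 then 1 else 0))
    (hSl : ∀ x x', Sl x x' = t * Ast x x' + h * Bst x x' + (1 - t - h) * (if x = x' then 1 else 0))
    (hg : ∀ N, g N = ∏ v, (μ0 v * W v) ^ (N v) / ((N v).factorial : ℝ))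
    (hZ : Z = ∑ x, g (comp x) * ((comp x (hub x) : ℝ) / W (hub x))) (hπS : ∀ x, πS x = g (comp x) * ((comp x (hub x) : ℝ) / W (hub x)) / Z)
    (u w : S) (hw : w ≠ u) {α β : ℝ} (hα0 : 0 < α) (hα1 : α ≤ 1) (hβ0 : 0 < β) (hβ1 : β ≤ 1)
    (hαu : ∀ v, v ≠ u → acc u v = α) (hβu : ∀ v, v ≠ u → acc v u = β)
    {cbar gs D0 Λ γ c : ℝ} (hcbar : cbar = μ0 u * α + (1 - μ0 u) * β) (hgs : gs = μ0 u * α / cbar) (hD0 : D0 = (1 - σ) + σ * α * β / cbar)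
    (hΛ : Λ = σ * (1 - σ) * cbar / D0) (hγ : γ = σ * (β - α) / D0) (hc : c = σ / D0) :
    ((K : ℝ) / ((t + h) * Λ) - 1) * (Real.log K / 2 - Real.log (72 * (1 + c) ^ 2 * Real.exp (2 * c) / Λ)) ≤ (mixingTime Sl πS (1 / 4) : ℝ) := by
  classical
  -- the swap odds
  set q : ℝ := t + h with hqdef
  have hq0 : 0 < q := by rw [hqdef]; linarith
  have hq1 : q ≤ 1 := hth
  have hσ0 : 0 < σ := by rw [hσ]; exact div_pos ht0 hq0
  have hσ1 : σ < 1 := by rw [hσ, div_lt_one hq0, hqdef]; linarith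
  have hσt : σ * q = t := by rw [hσ]; field_simp
  have hσh : (1 - σ) * q = h := by rw [hσ]; field_simp; ring
  -- the hub law of `u`
  have hp0 : 0 < μ0 u := hμpos u
  have hp1 : μ0 u < 1 := persistent_hubLaw_lt_one hμ1 hμpos hw
  have hK1 : 1 ≤ K := by omega
  have hK0 : (0 : ℝ) < K := by exact_mod_cast (show 0 < K by omega)
  have hK1r : (1 : ℝ) ≤ K := by exact_mod_cast hK1
  -- file 3a's constants
  have hgsb := pairEigen_gs_bounds hα0 hα1 hβ0 hβ1 hp0 hp1 hcbar hgs
  have hcc := pairEigen_c_bounds hσ0 hσ1 hα0 hα1 hβ0 hβ1 hp0 hp1 hcbar hD0 hc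
  have hΛb := pairEigen_Λ_bounds hσ0 hσ1 hα0 hα1 hβ0 hβ1 hp0 hp1 hcbar hD0 hΛ hc
  have hγc := pairEigen_abs_γ_le_c hσ0 hσ1 hα0 hα1 hβ0 hβ1 hp0 hp1 hcbar hD0 hγ hc
  have hcK : c ≤ K := by
    have h1 : σ / (1 - σ) ≤ K := by rw [div_le_iff₀ (by linarith)]; linarith
    exact le_trans hcc.2 h1
  -- the statistic
  set f : ℕ → ℝ := fun G => ((G : ℝ) - gs * K) * Real.exp (γ * (((G : ℝ) - gs * K) / K)) with hfdef
  set κ : ℕ → ℝ := fun G => c * ((α * ((K : ℝ) - G) + β * G) / K) * Real.exp (γ * (((G : ℝ) - gs * K) / K)) with hκdef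
  have hf : ∀ G : ℕ, f G = ((G : ℝ) - gs * K) * Real.exp (γ * (((G : ℝ) - gs * K) / K)) := fun G => rfl
  have hκ : ∀ G : ℕ, κ G = c * ((α * ((K : ℝ) - G) + β * G) / K) * Real.exp (γ * (((G : ℝ) - gs * K) / K)) := fun G => rfl
  set Gc : X → ℕ := fun x => comp x u - (if hub x = u then 1 else 0) with hGcdef
  have hG : ∀ x, Gc x = comp x u - (if hub x = u then 1 else 0) := fun x => rfl
  set Φ : X → ℝ := fun x => f (Gc x) + (if hub x = u then κ (Gc x) else 0) with hΦdef
  have hΦ : ∀ x, Φ x = f (Gc x) + (if hub x = u then κ (Gc x) else 0) := fun x => rfl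
  -- the auxiliary step chain at swap odds `σ`, and `S_l = qS_σ + (1−q)I`
  obtain ⟨Sst, hS⟩ : ∃ Sst : X → X → ℝ, ∀ x x', Sst x x' = σ * Ast x x' + (1 - σ) * Bst x x' :=
    ⟨fun x x' => σ * Ast x x' + (1 - σ) * Bst x x', fun _ _ => rfl⟩
  have hSl' : ∀ x x', Sl x x' = q * Sst x x' + (1 - q) * (if x = x' then 1 else 0) := by
    intro x x'
    rw [hSl, hS]
    have e1 : q * (σ * Ast x x' + (1 - σ) * Bst x x') = (σ * q) * Ast x x' + ((1 - σ) * q) * Bst x x' := by ring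
    rw [e1, hσt, hσh, hqdef]
    ring
  -- the chains: row-stochastic, `π_S` stationary, `S_l` `¼`-close at some time
  have hμ0 : ∀ v, 0 ≤ μ0 v := fun v => (hμpos v).le
  have hπ := lumpedStar_piS_pos hhub hW hμpos hg hZ hπS
  have hπ1 := lumpedStar_piS_sum hhub hW hμpos hg hZ hπS
  have hA0 : ∀ x x', 0 ≤ Ast x x' := starStep_swap_nonneg hW hacc hK1 hsum hKoff hKdiag hA
  have hA1 : ∀ x, ∑ x', Ast x x' = 1 := starStep_swap_rowsum hinj hsurj hhub hsum hKoff hKdiag hA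
  have hB0 : ∀ x x', 0 ≤ Bst x x' := fun x x' => by rw [hB]; exact mul_nonneg (hμ0 _) (by split_ifs <;> norm_num)
  have hB1 : ∀ x, ∑ x', Bst x x' = 1 := starStep_redraw_rowsum hinj hsurj hhub hsum hμ1 hB
  have hArev : ∀ x x', πS x * Ast x x' = πS x' * Ast x' x := starStep_swap_reversible hinj hhub hW hacc hKoff hA hπS
  have hBrev : ∀ x x', πS x * Bst x x' = πS x' * Bst x' x := starStep_redraw_reversible hhub hW hg hπS hB
  have hSrs : IsRowStochastic Sst := by
    refine ⟨fun x y => by rw [hS]; exact add_nonneg (mul_nonneg hσ0.le (hA0 x y)) (mul_nonneg (by linarith) (hB0 x y)), fun x => ?_⟩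
    simp_rw [hS]; rw [sum_add_distrib, ← mul_sum, ← mul_sum, hA1, hB1]; ring
  have hSlrs : IsRowStochastic Sl := lazyq_isRowStochastic hSrs hq0.le hq1 hSl'
  have hI : ∀ y, ∑ x, πS x * (if x = y then (1 : ℝ) else 0) = πS y := fun y => by
    simp only [mul_ite, mul_one, mul_zero, Finset.sum_ite_eq', Finset.mem_univ, if_true]
  have hst : IsStationary πS Sl := by
    intro y
    calc ∑ x, πS x * Sl x y = ∑ x, (t * (πS y * Ast y x) + h * (πS y * Bst y x) + (1 - t - h) * (πS x * (if x = y then 1 else 0))) :=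
          sum_congr rfl fun x _ => by rw [hSl, ← hArev, ← hBrev]; ring
      _ = t * (πS y * ∑ x, Ast y x) + h * (πS y * ∑ x, Bst y x) + (1 - t - h) * ∑ x, πS x * (if x = y then 1 else 0) := by
          rw [sum_add_distrib, sum_add_distrib, ← mul_sum, ← mul_sum, ← mul_sum, ← mul_sum, ← mul_sum]
      _ = πS y := by rw [hA1, hB1, hI]; ring
  have hirrS := lumpedStar_step_irreducible hsurj hhub hW hacc hK1 hsum hKoff hKdiag hμpos hσ0 hσ1 hA hB hS
  have hirr := lazyq_isIrreducible (S := Sst) hSrs.1 hq0 hq1 hSl' hirrS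
  have hap : IsAperiodic Sl := isAperiodic_of_diag_pos fun x => by
    rw [hSl]
    have hBxx : Bst x x = μ0 (hub x) := by rw [hB, if_pos rfl, mul_one]
    have h1 : 0 < h * Bst x x := by rw [hBxx]; exact mul_pos hh0 (hμpos _)
    have h2 := mul_nonneg ht0.le (hA0 x x)
    have h3 : 0 ≤ (1 - t - h) * (if x = x then (1 : ℝ) else 0) := by rw [if_pos rfl, mul_one]; linarith
    linarith
  have hmix : ∃ t₀, worstTvDist Sl πS t₀ ≤ 1 / 4 := exists_worstTvDist_le hSlrs hirr hap hst (fun x => (hπ x).le) hπ1 (by norm_num)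
  -- the defect of `S_σ` (files 3b, 4), hence of `S_l`
  set δ : ℝ := 4 * c * (1 + c) * Real.exp c / K with hδdef
  have hE1 : ∀ G : ℕ, G ≤ K → |σ * α * (((K : ℝ) - G) / K) * (f (G + 1) - f G - κ G) - (1 - σ) * (1 - μ0 u) * κ G + Λ / K * (f G + κ G)| ≤ δ :=
    fun G hGK => pairEigen_defect_one hσ0 hσ1 hα0 hα1 hβ0 hβ1 hp0 hp1 hcbar hgs hD0 hΛ hγ hc hf hκ hK1 hcK hGK
  have hE0 : ∀ G : ℕ, G ≤ K → |σ * β * ((G : ℝ) / K) * (f (G - 1) + κ (G - 1) - f G) + (1 - σ) * μ0 u * κ G + Λ / K * f G| ≤ δ :=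
    fun G hGK => pairEigen_defect_zero hσ0 hσ1 hα0 hα1 hβ0 hβ1 hp0 hp1 hcbar hgs hD0 hΛ hγ hc hf hκ hK1 hcK hGK
  have hdefS : ∀ x, |∑ y, Sst x y * Φ y - (1 - Λ / K) * Φ x| ≤ δ :=
    fun x => pair_step_defect hinj hsurj hhub hsum hμ1 hKoff hKdiag hA hB hS hαu hβu hG hΦ hE1 hE0 x
  set lam : ℝ := 1 - q * Λ / K with hlamdef
  have hsumSl : ∀ x, ∑ y, Sl x y * Φ y = q * ∑ y, Sst x y * Φ y + (1 - q) * Φ x := by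
    intro x
    have e : ∀ y, Sl x y * Φ y = q * (Sst x y * Φ y) + (1 - q) * ((if x = y then (1 : ℝ) else 0) * Φ y) := fun y => by rw [hSl']; ring
    rw [sum_congr rfl fun y _ => e y, sum_add_distrib, ← mul_sum, ← mul_sum]
    congr 2
    simp only [ite_mul, one_mul, zero_mul, Finset.sum_ite_eq, Finset.mem_univ, if_true]
  have hdef : ∀ x, |∑ y, Sl x y * Φ y - lam * Φ x| ≤ q * δ := by
    intro x
    rw [hsumSl x, hlamdef]
    have e : q * ∑ y, Sst x y * Φ y + (1 - q) * Φ x - (1 - q * Λ / K) * Φ x = q * (∑ y, Sst x y * Φ y - (1 - Λ / K) * Φ x) := by ring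
    rw [e, abs_mul, abs_of_pos hq0]
    exact mul_le_mul_of_nonneg_left (hdefS x) hq0.le
  -- the jumps
  have hJc := persistent_jump_constants hcc.1.le
  set E₁ : ℝ := (1 + c) ^ 2 * Real.exp c with hE₁def
  have hE₁1 : 1 ≤ E₁ := hJc.1
  have hJ₁ : ∀ G : ℕ, G ≤ K → |f (G + 1) - f G| ≤ 2 * (1 + c) ^ 2 * Real.exp c :=
    fun G hGK => pairEigen_f_succ_sub hσ0 hσ1 hα0 hα1 hβ0 hβ1 hp0 hp1 hcbar hgs hD0 hγ hc hf hK1 hcK hGK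
  have hJ₂ : ∀ G : ℕ, G ≤ K → |κ G| ≤ c * Real.exp c := by
    intro G hGK
    have hb := pairEigen_κ_bounds hσ0 hσ1 hα0 hα1 hβ0 hβ1 hp0 hp1 hcbar hgs hD0 hγ hc hκ hK1 hGK
    rw [abs_of_nonneg hb.1]; exact hb.2
  have hJ₁0 : 0 ≤ 2 * (1 + c) ^ 2 * Real.exp c := by positivity
  have hJ₂0 : 0 ≤ c * Real.exp c := by have := hcc.1; positivity
  have hRS : ∀ x, ∑ y, Sst x y * (Φ y - Φ x) ^ 2 ≤ (2 * (1 + c) ^ 2 * Real.exp c + c * Real.exp c) ^ 2 :=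
    fun x => pair_step_sq_increment hinj hhub hsum hA hB hS hSrs hG hΦ hJ₁0 hJ₂0 hJ₁ hJ₂ x
  have hR : ∀ x, ∑ y, Sl x y * (Φ y - Φ x) ^ 2 ≤ q * (2 * (1 + c) ^ 2 * Real.exp c + c * Real.exp c) ^ 2 := by
    intro x
    have e : ∀ y, Sl x y * (Φ y - Φ x) ^ 2 = q * (Sst x y * (Φ y - Φ x) ^ 2) + (1 - q) * ((if x = y then (1 : ℝ) else 0) * (Φ y - Φ x) ^ 2) :=
      fun y => by rw [hSl']; ring
    rw [sum_congr rfl fun y _ => e y, sum_add_distrib, ← mul_sum, ← mul_sum]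
    have h0 : ∑ y, (if x = y then (1 : ℝ) else 0) * (Φ y - Φ x) ^ 2 = 0 := by
      simp only [ite_mul, one_mul, zero_mul, Finset.sum_ite_eq, Finset.mem_univ, if_true, sub_self]; ring
    rw [h0, mul_zero, add_zero]
    exact mul_le_mul_of_nonneg_left (hRS x) hq0.le
  -- file 1's constants
  have hlam1 : lam < 1 := by rw [hlamdef]; have := div_pos (mul_pos hq0 hΛb.1) hK0; linarith
  have hqΛK : q * Λ / K < 1 := by
    rw [div_lt_one hK0]
    have : q * Λ ≤ 1 * Λ := mul_le_mul_of_nonneg_right hq1 hΛb.1.le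
    linarith [hΛb.2.2]
  have hlam0 : 0 < lam := by rw [hlamdef]; linarith
  have h1lam : 1 - lam = q * Λ / K := by rw [hlamdef]; ring
  have hδ0 : 0 ≤ δ := by rw [hδdef]; have := hcc.1; positivity
  have hqδ0 : 0 ≤ q * δ := mul_nonneg hq0.le hδ0
  have hδE : δ ≤ 4 * E₁ / K := by rw [hδdef]; exact div_le_div_of_nonneg_right hJc.2.1 hK0.le
  have hR0 : 0 ≤ q * (2 * (1 + c) ^ 2 * Real.exp c + c * Real.exp c) ^ 2 := mul_nonneg hq0.le (sq_nonneg _)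
  have hR9 : (2 * (1 + c) ^ 2 * Real.exp c + c * Real.exp c) ^ 2 ≤ 9 * E₁ ^ 2 := hJc.2.2
  set D : ℝ := 7 * E₁ * Real.sqrt (K : ℝ) / Λ with hDdef
  have hDpos : 0 < D := by
    rw [hDdef]
    have h1 : 0 < Real.sqrt (K : ℝ) := Real.sqrt_pos.mpr hK0
    have h2 : 0 < E₁ := by linarith
    exact div_pos (by positivity) hΛb.1
  -- `q` cancels in file 1's variance budget and in the mean shift
  have hcancel1 : (q * (2 * (1 + c) ^ 2 * Real.exp c + c * Real.exp c) ^ 2 + 2 * (q * δ) ^ 2 / (1 - lam)) / (1 - lam)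
      = ((2 * (1 + c) ^ 2 * Real.exp c + c * Real.exp c) ^ 2 + 2 * δ ^ 2 / (Λ / K)) / (Λ / K) := by
    rw [h1lam]; field_simp
  have hcancel2 : 2 * (q * δ) / (1 - lam) = 2 * δ / (Λ / K) := by rw [h1lam]; field_simp
  have hDsq : (q * (2 * (1 + c) ^ 2 * Real.exp c + c * Real.exp c) ^ 2 + 2 * (q * δ) ^ 2 / (1 - lam)) / (1 - lam) ≤ D ^ 2 := by
    rw [hcancel1, hDdef]
    exact persistent_floor_constants hΛb.1 hΛb.2.2.le hK1r hδ0 hδE hR9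
  -- the start: whichever of `g⋆`, `1 − g⋆` is at least `½`
  have hstart : ∃ x₀ : X, (K : ℝ) / 2 * Real.exp (-c) ≤ |Φ x₀| := by
    rcases le_or_gt gs (1 / 2) with hle | hgt
    · -- the `u`-crowded composition with hub `u`: `G = K`, `Φ = f K + κ K ≥ K(1−g⋆)e^{−c}`
      obtain ⟨x₁, hx₁, hc₁⟩ := hsurj u (fun v => if v = u then K + 1 else 0) (by rw [Finset.sum_ite_eq']; simp) (by simp)
      refine ⟨x₁, ?_⟩
      have hG₁ : Gc x₁ = K := by rw [hG, hc₁, if_pos hx₁]; simp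
      have hΦ₁ : Φ x₁ = f K + κ K := by rw [hΦ, hG₁, if_pos hx₁]
      have h := pairEigen_start_crowded hσ0 hσ1 hα0 hα1 hβ0 hβ1 hp0 hp1 hcbar hgs hD0 hγ hc hf hκ hK1
      rw [hΦ₁]
      have hhalf : (K : ℝ) / 2 ≤ (K : ℝ) * (1 - gs) := by
        have : (1 : ℝ) / 2 ≤ 1 - gs := by linarith
        calc (K : ℝ) / 2 = (K : ℝ) * (1 / 2) := by ring
          _ ≤ (K : ℝ) * (1 - gs) := mul_le_mul_of_nonneg_left this hK0.le
      calc (K : ℝ) / 2 * Real.exp (-c) ≤ (K : ℝ) * (1 - gs) * Real.exp (-c) := mul_le_mul_of_nonneg_right hhalf (Real.exp_pos _).le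
        _ ≤ f K + κ K := h
        _ ≤ |f K + κ K| := le_abs_self _
    · -- a `u`-free composition with hub `w`: `G = 0`, `Φ = f 0 ≤ −Kg⋆e^{−c}`
      obtain ⟨x₀, hx₀, hc₀⟩ := hsurj w (fun v => if v = w then K + 1 else 0) (by rw [Finset.sum_ite_eq']; simp) (by simp)
      refine ⟨x₀, ?_⟩
      have hxu : hub x₀ ≠ u := by rw [hx₀]; exact hw
      have hG₀ : Gc x₀ = 0 := by rw [hG, hc₀, if_neg hxu]; simp [Ne.symm hw]
      have hΦ₀ : Φ x₀ = f 0 := by rw [hΦ, hG₀, if_neg hxu, add_zero]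
      have h := pairEigen_start_free hα0 hα1 hβ0 hβ1 hp0 hp1 hcbar hgs hγc hf hK1
      rw [hΦ₀]
      have hhalf : (K : ℝ) / 2 ≤ (K : ℝ) * gs := by
        calc (K : ℝ) / 2 = (K : ℝ) * (1 / 2) := by ring
          _ ≤ (K : ℝ) * gs := mul_le_mul_of_nonneg_left hgt.le hK0.le
      calc (K : ℝ) / 2 * Real.exp (-c) ≤ (K : ℝ) * gs * Real.exp (-c) := mul_le_mul_of_nonneg_right hhalf (Real.exp_pos _).le
        _ ≤ -f 0 := h
        _ ≤ |f 0| := neg_le_abs _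
  obtain ⟨x₀, hx₀⟩ := hstart
  -- file 1
  have hfloor := approxEigen_mixingTime_ge hSlrs hdef hlam0 hlam1 hR0 hR (fun x => (hπ x).le) hπ1 hst hmix hDpos hDsq x₀
  -- the displayed form
  have hcoef : lam / (1 - lam) = (K : ℝ) / (q * Λ) - 1 := by
    rw [hlamdef]; field_simp [hΛb.1.ne', hq0.ne']; ring
  have hcoef0 : 0 ≤ (K : ℝ) / (q * Λ) - 1 := by
    rw [sub_nonneg, le_div_iff₀ (mul_pos hq0 hΛb.1)]
    have : q * Λ ≤ 1 * Λ := mul_le_mul_of_nonneg_right hq1 hΛb.1.le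
    linarith [hΛb.2.2]
  have hlog : Real.log K / 2 - Real.log (72 * (1 + c) ^ 2 * Real.exp (2 * c) / Λ) ≤ Real.log (|Φ x₀| / (2 * (q * δ) / (1 - lam) + 4 * D)) := by
    have hδΛ : δ / (Λ / K) ≤ 4 * E₁ / Λ := by
      rw [div_div_eq_mul_div]
      apply div_le_div_of_nonneg_right _ hΛb.1.le
      calc δ * K ≤ 4 * E₁ / K * K := mul_le_mul_of_nonneg_right hδE hK0.le
        _ = 4 * E₁ := by field_simp
    have hl := persistent_floor_log hΛb.1 hK1r hE₁1 hδ0 hδΛ hx₀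
    have e : 72 * E₁ * Real.exp c / Λ = 72 * (1 + c) ^ 2 * Real.exp (2 * c) / Λ := by
      rw [hE₁def, show (2 : ℝ) * c = c + c by ring, Real.exp_add]; ring
    rw [hcancel2, hDdef, ← e]
    exact hl
  rw [hcoef] at hfloor
  exact le_trans (mul_le_mul_of_nonneg_left hlog hcoef0) hfloor

/-- **THE SAME FOR X5's STEP CHAIN `S = σA + (1−σ)B`** (`h = 1−σ`, `t = σ`): with `0 < σ < 1`, `σ ≤ (1−σ)K` and the data above,
**`t_mix^{steps}(1/4) ≥ (K/Λ − 1)·(½·log K − log(72(1+c)²e^{2c}/Λ))`**, unconditionally in the chain and for every hub law. [ours] -/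
theorem lumpedStar_step_mixingTime_ge_persistent [Nonempty X] (hinj : ∀ x x', hub x = hub x' → comp x = comp x' → x = x')
    (hsurj : ∀ (z : S) (N : S → ℕ), ∑ v, N v = K + 1 → N z ≠ 0 → ∃ x, hub x = z ∧ comp x = N) (hhub : ∀ x, comp x (hub x) ≠ 0)
    (hsum : ∀ x, ∑ v, comp x v = K + 1) (hK : 2 ≤ K) (hW : ∀ v, 0 < W v) (hacc : ∀ h v, acc h v = min 1 (W h / W v)) (hμ1 : ∑ v, μ0 v = 1) (hμpos : ∀ v, 0 < μ0 v)
    (hσ0 : 0 < σ) (hσ1 : σ < 1) (hKσ : σ ≤ (1 - σ) * K)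
    (hKoff : ∀ N h v, h ≠ v → Kh N h v = if N h = 0 then 0 else (N v : ℝ) / K * acc h v) (hKdiag : ∀ N h, Kh N h h = 1 - ∑ v ∈ univ.erase h, Kh N h v)
    (hA : ∀ x x', Ast x x' = if comp x' = comp x then Kh (comp x) (hub x) (hub x') else 0)
    (hB : ∀ x x', Bst x x' = μ0 (hub x') * (if comp x' + Pi.single (hub x) 1 = comp x + Pi.single (hub x') 1 then 1 else 0))
    (hS : ∀ x x', Sst x x' = σ * Ast x x' + (1 - σ) * Bst x x')
    (hg : ∀ N, g N = ∏ v, (μ0 v * W v) ^ (N v) / ((N v).factorial : ℝ))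
    (hZ : Z = ∑ x, g (comp x) * ((comp x (hub x) : ℝ) / W (hub x))) (hπS : ∀ x, πS x = g (comp x) * ((comp x (hub x) : ℝ) / W (hub x)) / Z)
    (u w : S) (hw : w ≠ u) {α β : ℝ} (hα0 : 0 < α) (hα1 : α ≤ 1) (hβ0 : 0 < β) (hβ1 : β ≤ 1)
    (hαu : ∀ v, v ≠ u → acc u v = α) (hβu : ∀ v, v ≠ u → acc v u = β)
    {cbar gs D0 Λ γ c : ℝ} (hcbar : cbar = μ0 u * α + (1 - μ0 u) * β) (hgs : gs = μ0 u * α / cbar) (hD0 : D0 = (1 - σ) + σ * α * β / cbar)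
    (hΛ : Λ = σ * (1 - σ) * cbar / D0) (hγ : γ = σ * (β - α) / D0) (hc : c = σ / D0) :
    ((K : ℝ) / Λ - 1) * (Real.log K / 2 - Real.log (72 * (1 + c) ^ 2 * Real.exp (2 * c) / Λ)) ≤ (mixingTime Sst πS (1 / 4) : ℝ) := by
  have hSl : ∀ x x', Sst x x' = σ * Ast x x' + (1 - σ) * Bst x x' + (1 - σ - (1 - σ)) * (if x = x' then 1 else 0) := fun x x' => by rw [hS]; ring
  have hσ' : σ = σ / (σ + (1 - σ)) := by rw [show σ + (1 - σ) = 1 by ring, div_one]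
  have h := lumpedStar_lazy_mixingTime_ge_persistent hinj hsurj hhub hsum hK hW hacc hμ1 hμpos hσ0 (by linarith) (by linarith) hσ' hKσ hKoff hKdiag hA hB hSl hg hZ hπS
    u w hw hα0 hα1 hβ0 hβ1 hαu hβu hcbar hgs hD0 hΛ hγ hc
  rw [show σ + (1 - σ) = (1 : ℝ) by ring, one_mul] at h
  exact h

end PersistentFloor

end Summit.Ventures.LatticeQCDFlow.Scaling

end
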